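import Summits.QuantumFields.YangMills.Theorems.BalabanUVNodesN26AtTheta13LiveStubD4BelowOfDriftTowerFlat
import Summits.QuantumFields.YangMills.Theorems.BalabanUVNodesN26AtRecord13BetaBoxOfDriftAtSlope

/-!
# DAG node N26 ∕ row (D4) — CRUX K2⁗ (stmt-QuantumFields-20291) — THE OBJECTS FACE OF THE β-BOX AT NODE 00's WITNESS FAMILIES: for every slope `s > 0` a threshold `ē(s) > 0` below which
# EVERY member `θ₁₃(n, ε₂₉)` of K0a's all-numerics live family carries, from the NODE O ∕ B ∕ E inputs there + N3 + `Valid` + (C-leaf) ALONE (NODE D supplied, N1 + seam PAID),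
# `AtSlopeCont (split₁₃ θ₁₃(n,ε₂₉)) γ₀ s` AT THE DISPLAYED BOX `γ₀ ≤ θ.γ` — and hence, for every (D1) drift `(d, A)` of the member's `β⁰`, the β-BOX
# `BetaLowerH b γ₀ (betaOfRecord₁₃ F N θ₁₃(n,ε₂₉)) ∧ BetaUpperH β′ γ₀ (betaOfRecord₁₃ F N θ₁₃(n,ε₂₉))` whenever `b ≤ d − 2A − s`, `d + 2A + s ≤ β′`

BINDER row (D4) OWNER lineage `b2b-balaban-beta-an4` (gen 134), cell `pub-balaban`; helper for crux K2⁗ `EndpointGivenBR13Sep` (stmt-QuantumFields-20291).  COMPANION of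
`…N26AtRecord13BetaBoxOfDriftAtSlope` (the β-side junction: (U) ∕ (LOW) at `betaOfRecord₁₃ F N θ` ⇐ drift + `AtSlopeCont`, record-generic and at `θ₁₅ᶜᶜ¹` on `]0, ½]`) and of
`…N26AtTheta13LiveStubD4BelowOfDriftTowerFlat` (p511525: the registered stub-2 BODY below a threshold, `∃ γ₁`-form at the (D1) datum's slope).

WHY THIS FILE.  The consumers displaying `(U)` at the witness families (N12 `…N12AtRecord13WitnessFamily` at `θ₁₃(n,·)`; K0a FILE 14d's β-box `BetaLowerH b (1∕2) β₁₃ ∧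
BetaUpperH β′ (1∕2) β₁₃` at `θ₁₅ᶜᶜ¹`, box `½ = θ₁₅ᶜᶜ¹.γ`) need `AtSlopeCont` AT A NAMED BOX `γ₀` (the β-box lives on `]0, γ₀]`), while the registered stub's shape — and p500978 §2 ∕
p511525 §1 — conclude `∃ γ₁ ≤ θ.γ, AtSlopeCont … γ₁ …` with the box hidden.  The (D4) family road (p492935 clause (ii)) proves `AtSlopeCont` AT the displayed box; this file exposes
that along the live family in the rows-below (downward-closed in the (2.9) letter `ε₂₉`) and witness-generic form of p511525, for a FREE slope `s` (the located slope-keyed twin: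
`AtSlopeCont` is monotone UP in the slope, only the seam reads it — dag-n26-c `atSlopeCont_mono_slope`; the jets-free knit's input `AtSlopeCont` at the drift `d` is `s := d`), and
composes it with the companion's `betaBox_of_drift_atSlopeCont`.

WHAT IS HERE (0 `def`, 0 `sorry`; ONE theorem, generic in the numerics `n` with `hκ : 20·(64·log 162 + 1) ≤ κ(n)`, `hnum : n.Pos`; general `N`):
★ `exists_thr_atSlopeCont_betaBox_below_theta13LiveOfNumerics_of_family_towerFlat` — `∃ (δs, Cs)` ∀ [NE9 tower data ∕ weights ∕ `M` ∕ geometry ∕ `q`] `(γ₀ μ ν α₂ c₀) (s) (hs0 : 0 < s)`,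
`∃ ē > 0, ∀ ε₂₉ ∈ ]0, ē]`: `4ε₂₉ < ε₀(n)`, Admissible, `ZtUnity`, and ∀ [the Stage-12 [B13] family of record at the member's FAITHFUL letters, box `γ₀ ≤ θ.γ`, (1.22) `hm`, N10's leaf,
letters law, runs ∕ laws ∕ `Restr`, N3, NE9 regularity ∕ positivity displays, the (4.4) seams (NODE B), the (1.7) data with `hconv` (NODE E), `Valid`, (C-leaf)]:
`AtSlopeCont (split₁₃ θ₁₃(n,ε₂₉)) γ₀ s ∧ ∀ d A b β′, OneLoopDrift d A β⁰(θ₁₃(n,ε₂₉)) → b ≤ d − 2A − s → d + 2A + s ≤ β′ → BetaLowerH b γ₀ β₁₃ ∧ BetaUpperH β′ γ₀ β₁₃`,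
`β₁₃ = betaOfRecord₁₃ F N θ₁₃(n,ε₂₉)`.  Proof: p511525 §0 `exists_thr_rows_theta13LiveOfNumerics` (rows G ∧ Z ∧ N1 ∧ seam below `ē(s)`), p492935 clause (ii) at the member's faithful
letters (`exists_chainTFac190H_betaOfRecord₁₃_of_family_towerFlat … .2.1`), the companion's §0.  USE at the C¹ witness: `n := stage12NumericsOfThm1CC1 F.L ε₀ B₃ B₃' a₀ a₁`
(`theta13OfThm1CC1_eq`, `rfl`), `hκ := kappaThreshold_le_2e4.trans (kp_n10_theta13OfThm1CC1 …)`, `hnum := stage12NumericsOfThm1CC1_pos …`, `γ₀ := 1∕2` (`hle` by `theta13OfThm1CC1_γ`);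
at θ₁₅ᶜ likewise with `stage12NumericsOfThm1C`.

HONEST FRAMING.  A REDUCTION: every NODE O ∕ 00 ∕ A, NODE B, NODE E input is a DISPLAYED hypothesis per member (the Stage-12 [B13] family of record with `n ↗`, the seams from the
tower's bond fields, the (1.7) test-vector limit `hconv`), as are N3, `Valid`, (C-leaf) and the drift letters; nothing of Bałaban's analysis is asserted; (D4) INSTANCE 0∕1 at every record
and witness family (critical-path width 0 = NODE O; D4 DISCHARGE NO DATE); `stub_d4AtSlopeCont13` ∕ K2⁗ NOT proved; (U) NOT discharged; N26 NOT discharged; counts unmoved; count-neutral.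
One finite four-torus programme at fixed ε per run — NOT the continuum limit, NOT ℝ⁴, NOT OS, NOT a mass gap, NOT Clay.  No `instance`, no `notation`, no `axiom`.
Sources (context): [I] = [Balaban1987RG1] CMP **109** (1987): Thm 2 p. 259, (1.7) p. 261, §1 p. 264 ((1.20)–(1.22)), (2.9) p. 266, (2.12)–(2.14) p. 268, (4.4) p. 281, (4.35) p. 290,
(5.10) p. 293; [II] = [Balaban1988RG2Cluster] CMP **116** (1988): p. 15, Lemma 3 (2.38) p. 20, (2.41) p. 21; [III] = [Balaban1988Convergent] CMP **119** (1988): (2.10) p. 256;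
[15] = [Balaban1985Variational] CMP **102** (1985): Thm 1 p. 279, (190) p. 308; [5] = [Balaban1984PropagatorsI] CMP **95** (1984): §3.
-/

noncomputable section

open scoped Matrix.Norms.L2Operator InnerProductSpace ComplexConjugate

namespace Summit.QuantumFields.YangMills.Theorems.BalabanUVNodesN26AtTheta13LiveAtSlopeBelowBetaBoxTowerFlat

open Literature.MathematicalPhysics.QuantumFieldTheory.Balaban1983to89
open Literature.MathematicalPhysics.QuantumFieldTheory.Balaban1983to89.FlowStep
open Literature.MathematicalPhysics.QuantumFieldTheory.Balaban1983to89.T4Continuum (T4Family)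
open Literature.MathematicalPhysics.QuantumFieldTheory.Balaban1983to89.Node00
open Literature.MathematicalPhysics.QuantumFieldTheory.Balaban1983to89.B13ScaleTransfer (Pt)
open Literature.MathematicalPhysics.QuantumFieldTheory.Balaban1983to89.TreeLengthTorus (TPt TDom proj)
open Literature.MathematicalPhysics.QuantumFieldTheory.Balaban1983to89.B4Sect5Torus (TSite)
open Literature.MathematicalPhysics.QuantumFieldTheory.Balaban1983to89.B12Decay510 (mixedDeriv)
open Literature.MathematicalPhysics.QuantumFieldTheory.Balaban1983to89.B12Decay510Torus (tcubeOf)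
open Literature.MathematicalPhysics.QuantumFieldTheory.Balaban1983to89.B9SectCLatticeCarrier (Bond bpos)
open Literature.MathematicalPhysics.QuantumFieldTheory.Balaban1983to89.B9Eq311L2Pairing (WL2)
open Literature.MathematicalPhysics.QuantumFieldTheory.Balaban1983to89.B9Eq315QTower (towerP UlevOf)
open Literature.MathematicalPhysics.QuantumFieldTheory.Balaban1983to89.B9Eq315QTorus (perCfg cornerSite)
open Literature.MathematicalPhysics.QuantumFieldTheory.Balaban1983to89.B9Eq319QprimeTorus (blockCoord)
open Literature.MathematicalPhysics.QuantumFieldTheory.Balaban1983to89.B9Eq316TowerFlatIsOneStep (siteCast towerP_eq_fineP_pow)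
open Literature.MathematicalPhysics.QuantumFieldTheory.Balaban1983to89.B7Prop1Explicit (U1 Wcx boxVec)
open Literature.MathematicalPhysics.QuantumFieldTheory.Balaban1983to89.B7Prop2Explicit (c2')
open Literature.MathematicalPhysics.QuantumFieldTheory.Balaban1983to89.B11Eq103H1Complex (BondL2K)
open Literature.MathematicalPhysics.QuantumFieldTheory.Balaban1983to89.B9Eq326OperatorTower (laplaceAk H1k)
open Literature.MathematicalPhysics.QuantumFieldTheory.Balaban1983to89.Beta.RemainderChainLattice
open Literature.MathematicalPhysics.QuantumFieldTheory.Balaban1983to89.Beta.RemainderLimitTorus (LDom limKernel tproj)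
open Literature.MathematicalPhysics.QuantumFieldTheory.Balaban1983to89.Beta.RemainderDecay190 (Consts190 Data190)
open Literature.MathematicalPhysics.QuantumFieldTheory.Balaban1983to89.Beta.RemainderDecay190HoloChain (ChainTFac190H)
open Literature.MathematicalPhysics.QuantumFieldTheory.Balaban1983to89.Beta.RemainderWOfRecordB13 (SpLaw Law213 NOfLayers)
open Summit.QuantumFields.BalabanUV.Gaps
open Summit.QuantumFields.BalabanUV.Gaps.BetaContFromD4Chain
open Summit.QuantumFields.YangMills.Theorems.BalabanUVNodesN26AtRecord13FamilyTowerFlat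
  (exists_chainTFac190H_betaOfRecord₁₃_of_family_towerFlat)
open Literature.MathematicalPhysics.QuantumFieldTheory.Balaban1983to89.B12TreeDecay (K₀ K₀_pos)
open Summit.QuantumFields.YangMills.Theorems.BalabanUVNodesN26AtRecord13Family (condsL_faithful_theta13LiveOfNumerics_iff_of_kappa_ge)
open Summit.QuantumFields.YangMills.Theorems.BalabanUVNodesN26AtRecord12KappaSufficient (kappaThreshold_le_2e4)
open Metric Filter Topology
open Literature.MathematicalPhysics.QuantumFieldTheory.Balaban1983to89.Beta.OneStepKernelFamily (TbalOf)
open Literature.MathematicalPhysics.QuantumFieldTheory.Balaban1983to89.Beta.OneStepResolventKernel (JetData)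
open Summit.QuantumFields.YangMills.Theorems.BalabanUVNodesN26AtTheta13LiveStubD4BelowOfDriftTowerFlat (exists_thr_rows_theta13LiveOfNumerics)

open Literature.MathematicalPhysics.QuantumFieldTheory.Balaban1983to89.Beta.Drift (OneLoopDrift)
open Summit.QuantumFields.YangMills.Theorems.BalabanUVNodesN26AtRecord13BetaBoxOfDriftAtSlope (betaBox_of_drift_atSlopeCont)

variable (F : T4Family) (N : ℕ) [NeZero N]

section BelowTheta13LiveAtSlopeBetaBox



-- NE9's tower structure data ([5] §3 ∕ [15]: block size `L ≥ 3`, the C⋆-algebra `𝔸`, its Hilbert model `W ≃ 𝔸`, the trace `τ`, `a, a′, ρ_w, A_Q`; the letters `a, a′` are `aQ, aQ'` here — K0a's witness owns the names `a₀, a₁`)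
variable (L : ℕ) [NeZero L] (hL : 1 ≤ L) (hL3 : 3 ≤ L)
  {𝔸 : Type*} [CStarAlgebra 𝔸] [Nontrivial 𝔸]
  {W : Type} [NormedAddCommGroup W] [InnerProductSpace ℂ W] [FiniteDimensional ℂ W] (φ : W ≃ₗ[ℂ] 𝔸)
  {Mφ Mφ' : ℝ} (hMφ : 0 ≤ Mφ) (hMφ' : 0 ≤ Mφ') (hφ : ∀ w, ‖φ w‖ ≤ Mφ * ‖w‖) (hφ' : ∀ X, ‖φ.symm X‖ ≤ Mφ' * ‖X‖)
  {aQ : ℝ} (haQ : 0 < aQ) {aQ' : ℝ} (haQ' : 0 < aQ')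
  (τ : 𝔸 →ₗ[ℂ] ℂ) {Cτ : ℝ} (hτ : ∀ X, ‖τ X‖ ≤ Cτ * ‖X‖) (hCτ : 0 ≤ Cτ) {Mτ : ℝ}
  (hτm : ∀ X Y : 𝔸, ‖τ (X * Y)‖ ≤ Mτ * ‖X‖ * ‖Y‖) (hMτ : 0 ≤ Mτ) {ρw : ℝ} (hρw : 0 ≤ ρw)
  (hτ₁ : ∀ X : 𝔸, τ (star X) = conj (τ X)) (hτ₂ : ∀ X Y : 𝔸, τ (X * Y) = τ (Y * X))
  (hφτ : ∀ X Y : 𝔸, ⟪φ.symm X, φ.symm Y⟫_ℂ = τ (star X * Y))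
  (AQ : ℝ) (hAQ16 : 16 * (((4 : ℕ) : ℝ) + 1) * (((4 : ℕ) : ℝ) + 4) * c2' 4 L ≤ AQ)

include hL3 hMφ hMφ' hφ hφ' haQ haQ' hτ hCτ hτm hMτ hρw hτ₁ hτ₂ hφτ hAQ16

variable (n : Stage12Numerics)

variable {n} in
/-- **★ THE ROWS-BELOW, WITNESS-GENERIC OBJECTS FACE OF THE β-BOX ALONG `θ₁₃(n, ·)`**: for `hκ`, `hnum : n.Pos`, NE9's data, tower weights, `M`, geometry, `q`, a box `γ₀`, channel,
`α₂`, residual `c₀` and EVERY slope `s > 0`, THERE IS `ē > 0` such that AT EVERY MEMBER `0 < ε₂₉ ≤ ē`: `4ε₂₉ < ε₀(n)`, Admissible, `ZtUnity`, and from the NODE O ∕ 00 ∕ A, NODE B, NODE E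
inputs there + N3 + `Valid` + (C-leaf) ALONE: `AtSlopeCont (split₁₃ θ₁₃(n,ε₂₉)) γ₀ s` AT THE DISPLAYED BOX `γ₀ ≤ θ₁₃(n,ε₂₉).γ` (p492935 clause (ii) at the member's faithful letters, the rows
G ∧ Z ∧ N1 ∧ seam paid by p511525 §0 `exists_thr_rows_theta13LiveOfNumerics`) AND, for every drift `(d, A)` of the member's one-loop numbers and every `b ≤ d − 2A − s`, `d + 2A + s ≤ β′`,
the β-BOX `BetaLowerH b γ₀ β₁₃ ∧ BetaUpperH β′ γ₀ β₁₃` at `β₁₃ = betaOfRecord₁₃ F N θ₁₃(n,ε₂₉)` (companion `betaBox_of_drift_atSlopeCont`).  Instance 0∕1.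
[cite: Balaban1987RG1, Thm 2 p.259, (1.20)-(1.22) p.264, (2.9) p.266, (2.12)-(2.14) p.268, (4.4) p.281, (4.35) p.290, (5.10) p.293; Balaban1988RG2Cluster, Lemma 3 (2.38) p.20 and (2.41) p.21; Balaban1988Convergent, (2.10) p.256; Balaban1985Variational, Thm 1 p.279, (190) p.308] -/
theorem exists_thr_atSlopeCont_betaBox_below_theta13LiveOfNumerics_of_family_towerFlat
    (hκ : 20 * (64 * Real.log 162 + 1) ≤ n.s2.lf.κ) (hnum : n.Pos) :
    ∃ δs Cs : ℝ, 0 < δs ∧ 0 ≤ Cs ∧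
      ∀ -- tower weights per scale `k` (height `k + 1`)
        (η : ℕ → ℝ) (_hηL : ∀ k, η k * (L : ℝ) ^ (k + 1) = 1) (cw₀ cw₁ : ℕ → ℝ) [∀ k, Fact (0 < cw₀ k)] [∀ k, Fact (0 < cw₁ k)]
        (_hw : ∀ k, cw₀ k * ((L : ℝ) ^ (k + 1)) ^ 4 = cw₁ k) (_hρ : ∀ k, |η k| ^ 4 / cw₀ k ≤ ρw)
        -- cube side, size indices, block-geometry letters, source direction ∕ value, the (190)-record under numerics only
        (M : ℕ) [NeZero M] (I : Type) (_i₀ : I) (η₀ L₀ M₀ Rg : ℕ → ℝ) (Hg : ℕ → Prop) (μ₀ : Fin 4) (w₀ : W)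
        (q : Consts190) (δr : ℝ) (_hδr : 0 < δr) (_hσ₀ : 0 < q.σ) (_hcR : B6.c0 δr (q.σ / δr) ^ 4 ≤ q.cR) (_hκB : 1 ≤ q.κB)
        (_hδ15 : q.δ15 ≤ δs) (_hCst : Cs ≤ q.Cst) (_hmw : ‖w₀‖ ≤ q.m) (_hθ1 : q.θ ≤ 1)
        (γ₀ : ℝ) (μ ν : Fin 4) (α₂ : ℝ) (c₀ : B13.Consts) (s : ℝ) (_hs0 : 0 < s),
      -- ★ A THRESHOLD, AND THE PRODUCT AT EVERY MEMBER BELOW IT (downward-closed in the (2.9) letter `ε₂₉`)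
      ∃ ē : ℝ, 0 < ē ∧ ∀ ε₂₉ : ℝ, 0 < ε₂₉ → ε₂₉ ≤ ē →
      4 * ε₂₉ < n.ν.ε₀ ∧ (theta13LiveOfNumerics F N n ε₂₉ (zeta316OfRecord F N n.ν n.τ9.M n.A₁) (RzOfRecord F N) (ZtOfRecord F N)).Admissible F N ∧ (theta13LiveOfNumerics F N n ε₂₉ (zeta316OfRecord F N n.ν n.τ9.M n.A₁) (RzOfRecord F N) (ZtOfRecord F N)).ZtUnity F N ∧
      ∀ -- AT THAT MEMBER: a Stage-12 [B13] FAMILY of record with the FAITHFUL letters (minimal `A₂`), the box, the leaf kernels with the (1.22) identification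
        (lamF : ResidB13Fam₁₂ F N (theta13LiveOfNumerics F N n ε₂₉ (zeta316OfRecord F N n.ν n.τ9.M n.A₁) (RzOfRecord F N) (ZtOfRecord F N)).toStage12Params)
        (_hle : γ₀ ≤ (theta13LiveOfNumerics F N n ε₂₉ (zeta316OfRecord F N n.ν n.τ9.M n.A₁) (RzOfRecord F N) (ZtOfRecord F N)).γ) (A1 : (k : ℕ) → (Fin (k + 1) → ℝ) → LDom 4 → Pt 4 → ℝ)
        (_hm : letI := (theta13LiveOfNumerics F N n ε₂₉ (zeta316OfRecord F N n.ν n.τ9.M n.A₁) (RzOfRecord F N) (ZtOfRecord F N)).instVβ₁; letI := (theta13LiveOfNumerics F N n ε₂₉ (zeta316OfRecord F N n.ν n.τ9.M n.A₁) (RzOfRecord F N) (ZtOfRecord F N)).instVβ₂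
          letI := (theta13LiveOfNumerics F N n ε₂₉ (zeta316OfRecord F N n.ν n.τ9.M n.A₁) (RzOfRecord F N) (ZtOfRecord F N)).instιβ
          ∀ k (v : Fin (k + 1) → ℝ), v ∈ Box γ₀ k →
            betaMerged F (mergedTermFamilyMatT F N (TcanOfRecord F N)
                (chiFixed29 F N (theta13LiveOfNumerics F N n ε₂₉ (zeta316OfRecord F N n.ν n.τ9.M n.A₁) (RzOfRecord F N) (ZtOfRecord F N)).ν (theta13LiveOfNumerics F N n ε₂₉ (zeta316OfRecord F N n.ν n.τ9.M n.A₁) (RzOfRecord F N) (ZtOfRecord F N)).ε₂₉)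
                (theta13LiveOfNumerics F N n ε₂₉ (zeta316OfRecord F N n.ν n.τ9.M n.A₁) (RzOfRecord F N) (ZtOfRecord F N)).εbg) (theta13LiveOfNumerics F N n ε₂₉ (zeta316OfRecord F N n.ν n.τ9.M n.A₁) (RzOfRecord F N) (ZtOfRecord F N)).ρ8
                (theta13LiveOfNumerics F N n ε₂₉ (zeta316OfRecord F N n.ν n.τ9.M n.A₁) (RzOfRecord F N) (ZtOfRecord F N)).bV k v =
              beta0OfMerged (betaMerged F (mergedTermFamilyMatT F N (TcanOfRecord F N)
                  (chiFixed29 F N (theta13LiveOfNumerics F N n ε₂₉ (zeta316OfRecord F N n.ν n.τ9.M n.A₁) (RzOfRecord F N) (ZtOfRecord F N)).ν (theta13LiveOfNumerics F N n ε₂₉ (zeta316OfRecord F N n.ν n.τ9.M n.A₁) (RzOfRecord F N) (ZtOfRecord F N)).ε₂₉)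
                  (theta13LiveOfNumerics F N n ε₂₉ (zeta316OfRecord F N n.ν n.τ9.M n.A₁) (RzOfRecord F N) (ZtOfRecord F N)).εbg) (theta13LiveOfNumerics F N n ε₂₉ (zeta316OfRecord F N n.ν n.τ9.M n.A₁) (RzOfRecord F N) (ZtOfRecord F N)).ρ8
                  (theta13LiveOfNumerics F N n ε₂₉ (zeta316OfRecord F N n.ν n.τ9.M n.A₁) (RzOfRecord F N) (ZtOfRecord F N)).bV) (theta13LiveOfNumerics F N n ε₂₉ (zeta316OfRecord F N n.ν n.τ9.M n.A₁) (RzOfRecord F N) (ZtOfRecord F N)).v₀ k +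
                B12Beta.secondMoment (fun _ _ => limKernel (A1 k v)) μ ν)
        -- N10's in-edge in the FAMILY currency at every run and the member letters law on the box, at the Stage-12 part (faithful letters of record of the member)
        (_hcF : ∀ P k v, v ∈ Box γ₀ k → (lamF P k v).c = c13OfRecord₁₂ F N (theta13LiveOfNumerics F N n ε₂₉ (zeta316OfRecord F N n.ν n.τ9.M n.A₁) (RzOfRecord F N) (ZtOfRecord F N)).toStage12Params { c₀ with ε₁ := ε₂₉, A₂ := Real.exp 1 * 9 * 64 * K₀ 64 8 ^ 2 })
        (_hleafF : ∀ P, B13FamLeafOfRecord₁₂ F N (theta13LiveOfNumerics F N n ε₂₉ (zeta316OfRecord F N n.ν n.τ9.M n.A₁) (RzOfRecord F N) (ZtOfRecord F N)).toStage12Params { c₀ with ε₁ := ε₂₉, A₂ := Real.exp 1 * 9 * 64 * K₀ 64 8 ^ 2 } lamF P)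
        -- per (scale, history) IN THE BOX: a RUN SEQUENCE whose members AT THAT HISTORY have growing coarse tori, their laws and restriction sentences
        (Ps : (k : ℕ) → (Fin (k + 1) → ℝ) → ℕ → B12.RunParams)
        (_hn : ∀ k v, v ∈ Box γ₀ k → Tendsto (fun m => (lamF (Ps k v m) k v).n) atTop atTop)
        (_hsp : ∀ k v, v ∈ Box γ₀ k → ∀ m, SpLaw (lamF (Ps k v m) k v))
        (_h213 : ∀ k v, v ∈ Box γ₀ k → ∀ m, Law213 (lamF (Ps k v m) k v))
        (_hR : ∀ k v, v ∈ Box γ₀ k → ∀ m, (lamF (Ps k v m) k v).Restr)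
        -- N3 (N1 and the seam row are PAID by the choice of the member)
        (_hs : SignsL (c13OfRecord₁₂ F N (theta13LiveOfNumerics F N n ε₂₉ (zeta316OfRecord F N n.ν n.τ9.M n.A₁) (RzOfRecord F N) (ZtOfRecord F N)).toStage12Params { c₀ with ε₁ := ε₂₉, A₂ := Real.exp 1 * 9 * 64 * K₀ 64 8 ^ 2 }) α₂ q.B₃)
        -- ANY admissible regularity display and positivity witness of `Δ_{a,k}(1)` per (k, v, m) on the tower over the member's torus
        (αU : (k : ℕ) → (Fin (k + 1) → ℝ) → ℕ → ℕ → ℝ) (hα1 : ∀ k v m j, αU k v m j ≤ 1 / 64)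
        (hαL : ∀ k v m j, 50 * (((4 : ℕ) : ℝ) + 1) * αU k v m j * (L : ℝ) ^ 4 ≤ 1 / 2)
        (hU1 : ∀ k v m (j : ℕ) (z : B7Prop1Explicit.Site 4) (κ : Fin 4),
          perCfg (towerP L (fun _ : Fin 4 => NOfLayers (fun m => lamF (Ps k v m) k v) m * M) (j + 1))
            (UlevOf L (fun _ : Fin 4 => NOfLayers (fun m => lamF (Ps k v m) k v) m * M) (k + 1) (fun _ => (1 : 𝔸ˣ)) j) z κ ∈ U1 𝔸)
        (hreg : ∀ k v m (j : ℕ) (y : TSite 4 (towerP L (fun _ : Fin 4 => NOfLayers (fun m => lamF (Ps k v m) k v) m * M) j)) (κ : Fin 4)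
          (ρ' : Fin 4 → Fin L),
          ‖((Wcx L (perCfg (towerP L (fun _ : Fin 4 => NOfLayers (fun m => lamF (Ps k v m) k v) m * M) (j + 1))
              (UlevOf L (fun _ : Fin 4 => NOfLayers (fun m => lamF (Ps k v m) k v) m * M) (k + 1) (fun _ => (1 : 𝔸ˣ)) j))
              (cornerSite L y) κ (boxVec L ρ') : 𝔸ˣ) : 𝔸) - 1‖ ≤ αU k v m j)
        (hpos : ∀ k v m (u : BondL2K ℂ 4 (towerP L (fun _ : Fin 4 => NOfLayers (fun m => lamF (Ps k v m) k v) m * M) (k + 1)) (cw₀ k) W), u ≠ 0 →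
          0 < RCLike.re ⟪u, laplaceAk L (fun _ : Fin 4 => NOfLayers (fun m => lamF (Ps k v m) k v) m * M) k φ (η k) (fun _ => (1 : 𝔸ˣ)) hL
            (αU k v m) (hα1 k v m) (hU1 k v m) (hreg k v m) τ (c₀ := cw₀ k) (c₁ := cw₁ k) aQ u⟫_ℂ)
        -- the (4.4) seams FROM THE TOWER's FINE BOND FIELDS into the members' spaces p. 15, the members' ACTIVITIES holomorphic along them (on the box)
        (emb : (k : ℕ) → (v : Fin (k + 1) → ℝ) → (m : ℕ) → TDom 4 ((lamF (Ps k v m) k v).n + 1) → (Bond 4 (towerP L (fun _ : Fin 4 => NOfLayers (fun m => lamF (Ps k v m) k v) m * M) (k + 1)) → W) → (lamF (Ps k v m) k v).Φ)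
        (_hemb : ∀ k v, v ∈ Box γ₀ k → ∀ m X, ∀ u ∈ ball (0 : Bond 4 (towerP L (fun _ : Fin 4 => NOfLayers (fun m => lamF (Ps k v m) k v) m * M) (k + 1)) → W) α₂, emb k v m X u ∈ (lamF (Ps k v m) k v).sp2 X)
        (_hH : ∀ k v, v ∈ Box γ₀ k → ∀ m (X Z : TDom 4 ((lamF (Ps k v m) k v).n + 1)), Z.1 ⊆ X.1 →
          DifferentiableOn ℂ (fun u => (lamF (Ps k v m) k v).H Z (emb k v m X u)) (ball 0 α₂))
        -- the (1.7) ∕ test-vector-limit data (on the box), the limit READ ON THE EXPLICIT FLAT TEST VECTORS, and the read-out of the leaf kernels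
        (V : (k : ℕ) → (Fin (k + 1) → ℝ) → LDom 4 → Type) (_instV : ∀ k v Y, NormedAddCommGroup (V k v Y))
        (_instVs : ∀ k v Y, NormedSpace ℂ (V k v Y))
        (Fw : (k : ℕ) → (v : Fin (k + 1) → ℝ) → (Y : LDom 4) → V k v Y → ℂ)
        (_hFd : ∀ k v, v ∈ Box γ₀ k → ∀ Y, ∃ ρ > 0, DifferentiableOn ℂ (Fw k v Y) (ball 0 ρ))
        (r : (k : ℕ) → (v : Fin (k + 1) → ℝ) → (m : ℕ) → (Y : LDom 4) → (Bond 4 (towerP L (fun _ : Fin 4 => NOfLayers (fun m => lamF (Ps k v m) k v) m * M) (k + 1)) → W) →L[ℂ] V k v Y)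
        (_hfac : ∀ k v, v ∈ Box γ₀ k → ∀ Y : LDom 4, ∀ᶠ m in atTop, ∀ u ∈ ball (0 : Bond 4 (towerP L (fun _ : Fin 4 => NOfLayers (fun m => lamF (Ps k v m) k v) m * M) (k + 1)) → W) α₂,
          (lamF (Ps k v m) k v).Ek1 (tproj ((lamF (Ps k v m) k v).n + 1) Y) (emb k v m (tproj ((lamF (Ps k v m) k v).n + 1) Y) u) = Fw k v Y (r k v m Y u))
        (t : (k : ℕ) → (v : Fin (k + 1) → ℝ) → (Y : LDom 4) → Pt 4 → V k v Y)
        (_hconv : ∀ k v, v ∈ Box γ₀ k → ∀ (Y : LDom 4) (x : Pt 4),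
          Tendsto (fun m => r k v m Y
            (fun b : Bond 4 (towerP L (fun _ : Fin 4 => NOfLayers (fun m => lamF (Ps k v m) k v) m * M) (k + 1)) =>
              if tcubeOf (NOfLayers (fun m => lamF (Ps k v m) k v) m) M (fun i => ((blockCoord (L ^ (k + 1)) (fun _ : Fin 4 => NOfLayers (fun m => lamF (Ps k v m) k v) m * M)
                    (siteCast (towerP_eq_fineP_pow L (fun _ : Fin 4 => NOfLayers (fun m => lamF (Ps k v m) k v) m * M) (k + 1)) (bpos b)) i : ℕ) :
                      ZMod (NOfLayers (fun m => lamF (Ps k v m) k v) m * M))) ∈ (tproj ((lamF (Ps k v m) k v).n + 1) Y).1 then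
                ((WL2.linearEquiv ℂ ℂ (fun _ : Bond 4 (towerP L (fun _ : Fin 4 => NOfLayers (fun m => lamF (Ps k v m) k v) m * M) (k + 1)) => cw₀ k) :
                    BondL2K ℂ 4 (towerP L (fun _ : Fin 4 => NOfLayers (fun m => lamF (Ps k v m) k v) m * M) (k + 1)) (cw₀ k) W ≃ₗ[ℂ] (Bond 4 (towerP L (fun _ : Fin 4 => NOfLayers (fun m => lamF (Ps k v m) k v) m * M) (k + 1)) → W))
                  (H1k L (fun _ : Fin 4 => NOfLayers (fun m => lamF (Ps k v m) k v) m * M) k φ (η k) (fun _ => (1 : 𝔸ˣ)) hL (αU k v m) (hα1 k v m)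
                    (hU1 k v m) (hreg k v m) τ (c₀ := cw₀ k) (c₁ := cw₁ k) (hαL k v m) (hpos k v m)
                    ((WL2.linearEquiv ℂ ℂ (fun _ : Bond 4 (fun _ : Fin 4 => NOfLayers (fun m => lamF (Ps k v m) k v) m * M) => cw₁ k) :
                        BondL2K ℂ 4 (fun _ : Fin 4 => NOfLayers (fun m => lamF (Ps k v m) k v) m * M) (cw₁ k) W ≃ₗ[ℂ]
                          (Bond 4 (fun _ : Fin 4 => NOfLayers (fun m => lamF (Ps k v m) k v) m * M) → W)).symm
                      (Pi.single ((fun i => (⟨((proj (((lamF (Ps k v m) k v).n + 1) * M) x) i).val,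
                          ZMod.val_lt ((proj (((lamF (Ps k v m) k v).n + 1) * M) x) i)⟩ : Fin (NOfLayers (fun m => lamF (Ps k v m) k v) m * M))), μ₀) w₀)))) b
              else 0)) atTop (𝓝 (t k v Y x)))
        (_ha : ∀ k v, v ∈ Box γ₀ k → ∀ (Y : LDom 4) (z : Pt 4), A1 k v Y z = (mixedDeriv (Fw k v Y) (t k v Y 0) (t k v Y z)).re)
        -- the box is a positive box, the (190) numerics validity at the letters, (C-leaf) in the (1.7) read-out letters
        (_hq : q.Valid (c13OfRecord₁₂ F N (theta13LiveOfNumerics F N n ε₂₉ (zeta316OfRecord F N n.ν n.τ9.M n.A₁) (RzOfRecord F N) (ZtOfRecord F N)).toStage12Params { c₀ with ε₁ := ε₂₉, A₂ := Real.exp 1 * 9 * 64 * K₀ 64 8 ^ 2 }).δ₀)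
        (_hcont : ∀ k (Y : LDom 4) (z : Pt 4),
          ContinuousOn (fun v : Fin (k + 1) → ℝ => (mixedDeriv (Fw k v Y) (t k v Y 0) (t k v Y z)).re) (Box γ₀ k)),
      letI := (theta13LiveOfNumerics F N n ε₂₉ (zeta316OfRecord F N n.ν n.τ9.M n.A₁) (RzOfRecord F N) (ZtOfRecord F N)).instVβ₁; letI := (theta13LiveOfNumerics F N n ε₂₉ (zeta316OfRecord F N n.ν n.τ9.M n.A₁) (RzOfRecord F N) (ZtOfRecord F N)).instVβ₂
      letI := (theta13LiveOfNumerics F N n ε₂₉ (zeta316OfRecord F N n.ν n.τ9.M n.A₁) (RzOfRecord F N) (ZtOfRecord F N)).instιβ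
      -- ★ the rows-(D4) ∧ B4 residue AT THE DISPLAYED BOX `γ₀` and the free slope `s` (NODE D supplied), and its β-BOX corollary from the (D1) drift letters there
      AtSlopeCont
          (oneLoopSplit_betaOfMerged
            (betaMerged F (mergedTermFamilyMatT F N (TcanOfRecord F N)
              (chiFixed29 F N (theta13LiveOfNumerics F N n ε₂₉ (zeta316OfRecord F N n.ν n.τ9.M n.A₁) (RzOfRecord F N) (ZtOfRecord F N)).ν (theta13LiveOfNumerics F N n ε₂₉ (zeta316OfRecord F N n.ν n.τ9.M n.A₁) (RzOfRecord F N) (ZtOfRecord F N)).ε₂₉)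
              (theta13LiveOfNumerics F N n ε₂₉ (zeta316OfRecord F N n.ν n.τ9.M n.A₁) (RzOfRecord F N) (ZtOfRecord F N)).εbg) (theta13LiveOfNumerics F N n ε₂₉ (zeta316OfRecord F N n.ν n.τ9.M n.A₁) (RzOfRecord F N) (ZtOfRecord F N)).ρ8
              (theta13LiveOfNumerics F N n ε₂₉ (zeta316OfRecord F N n.ν n.τ9.M n.A₁) (RzOfRecord F N) (ZtOfRecord F N)).bV)
            (beta0OfMerged (betaMerged F (mergedTermFamilyMatT F N (TcanOfRecord F N)
              (chiFixed29 F N (theta13LiveOfNumerics F N n ε₂₉ (zeta316OfRecord F N n.ν n.τ9.M n.A₁) (RzOfRecord F N) (ZtOfRecord F N)).ν (theta13LiveOfNumerics F N n ε₂₉ (zeta316OfRecord F N n.ν n.τ9.M n.A₁) (RzOfRecord F N) (ZtOfRecord F N)).ε₂₉)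
              (theta13LiveOfNumerics F N n ε₂₉ (zeta316OfRecord F N n.ν n.τ9.M n.A₁) (RzOfRecord F N) (ZtOfRecord F N)).εbg) (theta13LiveOfNumerics F N n ε₂₉ (zeta316OfRecord F N n.ν n.τ9.M n.A₁) (RzOfRecord F N) (ZtOfRecord F N)).ρ8
              (theta13LiveOfNumerics F N n ε₂₉ (zeta316OfRecord F N n.ν n.τ9.M n.A₁) (RzOfRecord F N) (ZtOfRecord F N)).bV) (theta13LiveOfNumerics F N n ε₂₉ (zeta316OfRecord F N n.ν n.τ9.M n.A₁) (RzOfRecord F N) (ZtOfRecord F N)).v₀)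
            (theta13LiveOfNumerics F N n ε₂₉ (zeta316OfRecord F N n.ν n.τ9.M n.A₁) (RzOfRecord F N) (ZtOfRecord F N)).γ)
          γ₀ s ∧
      ∀ d A b β' : ℝ,
        OneLoopDrift d A
          (beta0OfMerged (betaMerged F (mergedTermFamilyMatT F N (TcanOfRecord F N)
            (chiFixed29 F N (theta13LiveOfNumerics F N n ε₂₉ (zeta316OfRecord F N n.ν n.τ9.M n.A₁) (RzOfRecord F N) (ZtOfRecord F N)).ν (theta13LiveOfNumerics F N n ε₂₉ (zeta316OfRecord F N n.ν n.τ9.M n.A₁) (RzOfRecord F N) (ZtOfRecord F N)).ε₂₉)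
            (theta13LiveOfNumerics F N n ε₂₉ (zeta316OfRecord F N n.ν n.τ9.M n.A₁) (RzOfRecord F N) (ZtOfRecord F N)).εbg) (theta13LiveOfNumerics F N n ε₂₉ (zeta316OfRecord F N n.ν n.τ9.M n.A₁) (RzOfRecord F N) (ZtOfRecord F N)).ρ8
            (theta13LiveOfNumerics F N n ε₂₉ (zeta316OfRecord F N n.ν n.τ9.M n.A₁) (RzOfRecord F N) (ZtOfRecord F N)).bV) (theta13LiveOfNumerics F N n ε₂₉ (zeta316OfRecord F N n.ν n.τ9.M n.A₁) (RzOfRecord F N) (ZtOfRecord F N)).v₀) →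
        b ≤ d - 2 * A - s → d + 2 * A + s ≤ β' →
        BetaLowerH b γ₀ (betaOfRecord₁₃ F N (theta13LiveOfNumerics F N n ε₂₉ (zeta316OfRecord F N n.ν n.τ9.M n.A₁) (RzOfRecord F N) (ZtOfRecord F N))) ∧ BetaUpperH β' γ₀ (betaOfRecord₁₃ F N (theta13LiveOfNumerics F N n ε₂₉ (zeta316OfRecord F N n.ν n.τ9.M n.A₁) (RzOfRecord F N) (ZtOfRecord F N))) := by
  obtain ⟨δs, Cs, hδs, hCs, H⟩ :=
    exists_chainTFac190H_betaOfRecord₁₃_of_family_towerFlat F N L hL hL3 φ hMφ hMφ' hφ hφ' haQ haQ' τ hτ hCτ hτm hMτ hρw hτ₁ hτ₂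
      hφτ AQ hAQ16
  refine ⟨δs, Cs, hδs, hCs, ?_⟩
  intro η hηL cw₀ cw₁ _ _ hw hρ M _ I i₀ η₀ L₀ M₀ Rg Hg μ₀ w₀ q δr hδr hσ₀ hcR hκB hδ15 hCst hmw hθ1 γ₀ μ ν α₂ c₀ s hs0
  obtain ⟨ē, hē, hrows⟩ := exists_thr_rows_theta13LiveOfNumerics F N c₀ M α₂ q.B₃ hκ hnum hs0
  refine ⟨ē, hē, fun ε₂₉ hε0 hεē => ?_⟩
  obtain ⟨h4, hAdm, hZt, hC, hsmall⟩ := hrows ε₂₉ hε0 hεē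
  refine ⟨h4, hAdm, hZt, ?_⟩
  intro lamF hle A1 hm hcF hleafF Ps hn hsp h213 hR hs αU hα1 hαL hU1 hreg hpos emb hemb hH V instV instVs Fw hFd r hfac t hconv ha
    hq hcont
  have hA :=
    (H η hηL cw₀ cw₁ hw hρ M I i₀ η₀ L₀ M₀ Rg Hg μ₀ w₀ q δr hδr hσ₀ hcR hκB hδ15 hCst hmw hθ1 γ₀ μ ν α₂ (theta13LiveOfNumerics F N n ε₂₉ (zeta316OfRecord F N n.ν n.τ9.M n.A₁) (RzOfRecord F N) (ZtOfRecord F N))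
      { c₀ with ε₁ := ε₂₉, A₂ := Real.exp 1 * 9 * 64 * K₀ 64 8 ^ 2 } lamF hle A1 hm hcF hleafF Ps hn hsp h213 hR hC hs αU hα1 hαL hU1
      hreg hpos emb hemb hH V instV instVs Fw hFd r hfac t hconv ha).2.1 hq s hsmall hcont
  exact ⟨hA, fun d A b β' hdrift hb hβ' => betaBox_of_drift_atSlopeCont _ hdrift hA hb hβ'⟩

end BelowTheta13LiveAtSlopeBetaBox

end Summit.QuantumFields.YangMills.Theorems.BalabanUVNodesN26AtTheta13LiveAtSlopeBelowBetaBoxTowerFlat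

end
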